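import Summits.Ventures.PercRepro.C041CycleStatus
import Summits.Ventures.PercRepro.C041TwoExitMain

/-!
# ROW C-041 — THE CYCLE DICTIONARY: the six-vector of the two-exit cycle IS mine-3's arc-type model `thetaCyc`
(p6, gen 31; C-041.md §20 (d), §21 (a) «the arc-type model is the cycle's six-vector», paper-level until now)

The cycle `cyc n` (`C_{n+1}` through the anchor `0`) with the zones `Z` at `x_i` and `Z'` at `x_j` (`0 < i < j`)
is the two-exit attachment `cyc2 n i j Z a Z' a'`; by THEOREM (TWO-EXIT BLOCK MAP) its six-vector is the sum over
the `2^{n+1}` colourings of the contribution of the statuses, and by `C041CycleStatus` the contribution of a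
colouring is mine-3's table `cycCol` at the types of the three arcs.  Grouping the colourings by their arc types
(`Finset.sum_fiberwise`) and COUNTING them — a colouring is the triple of its restrictions to the arcs
(`arcsEquiv`), and an arc of length `ℓ` is all blue in `1` way, all red in `1` way and mixed in `2^ℓ − 2` ways
(`card_codeF`) — gives

* **`sixVec_cyc2`** — `Π(cyc2 n i j Z a Z' a') = thetaCyc (2^ℓ₁ − 2) (2^ℓ₂ − 2) (2^ℓ₃ − 2) (Π Z) (Π Z')` with
  `ℓ₁ = i`, `ℓ₂ = j − i`, `ℓ₃ = n + 1 − j` — the dictionary for EVERY cycle length, EVERY pair of exit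
  positions and ANY two zones.

Hence mine-3's theorems on `thetaCyc` — `K4v_thetaCyc_marks` / `K4v_thetaCyc_lengths` (THEOREM (CYCLES WITH
TWO MARKED VERTICES), `C041CycleRelaxed`) and `InCone_thetaCyc_marks_lengths` (`C041TriangleMixedFamily`) —
hold for the cycle zones of the graph model.
-/

namespace PercRepro

namespace ZoneZ

namespace TwoExit

open ZoneData Pendant TreeClosure RelaxedTriangle Finset

/-! ## Counting the colourings of one arc by type -/

section OneArc

variable {S : Type} [Fintype S] [DecidableEq S]

open Classical in
/-- The type of a colouring of an arc: `0` all blue, `1` all red, `2` mixed. -/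
noncomputable def codeF (f : S → Bool) : Fin 3 :=
  if (∀ s, f s = false) then 0 else if (∀ s, f s = true) then 1 else 2

/-- The multiplicity of a type on an arc of length `ℓ`: `1`, `1`, `2^ℓ − 2`. -/
def multN (t : Fin 3) (ℓ : ℕ) : ℕ := if t = 2 then 2 ^ ℓ - 2 else 1

open Classical in
/-- The all-blue colouring is the only one of type `0`. -/
theorem card_codeF_zero :
    #(univ.filter fun f : S → Bool => codeF f = 0) = 1 := by
  rw [Finset.card_eq_one]
  refine ⟨fun _ => false, ?_⟩
  ext f
  rw [Finset.mem_filter, Finset.mem_singleton]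
  simp only [Finset.mem_univ, true_and]
  unfold codeF
  constructor
  · intro h
    by_cases h0 : ∀ s, f s = false
    · exact funext h0
    · rw [if_neg h0] at h
      by_cases h1 : ∀ s, f s = true
      · rw [if_pos h1] at h
        exact absurd h (by decide)
      · rw [if_neg h1] at h
        exact absurd h (by decide)
  · rintro rfl
    rw [if_pos fun _ => rfl]

open Classical in
/-- The all-red colouring is the only one of type `1`. -/
theorem card_codeF_one (hS : Nonempty S) :
    #(univ.filter fun f : S → Bool => codeF f = 1) = 1 := by
  rw [Finset.card_eq_one]
  refine ⟨fun _ => true, ?_⟩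
  ext f
  rw [Finset.mem_filter, Finset.mem_singleton]
  simp only [Finset.mem_univ, true_and]
  unfold codeF
  constructor
  · intro h
    by_cases h0 : ∀ s, f s = false
    · rw [if_pos h0] at h
      exact absurd h (by decide)
    · rw [if_neg h0] at h
      by_cases h1 : ∀ s, f s = true
      · exact funext h1
      · rw [if_neg h1] at h
        exact absurd h (by decide)
  · rintro rfl
    obtain ⟨s⟩ := hS
    rw [if_neg (fun h => Bool.false_ne_true (h s).symm), if_pos fun _ => rfl]

open Classical in
/-- The mixed colourings: `2^ℓ − 2` of them. -/
theorem card_codeF_two (hS : Nonempty S) :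
    #(univ.filter fun f : S → Bool => codeF f = 2) = 2 ^ Fintype.card S - 2 := by
  have h0 := card_codeF_zero (S := S)
  have h1 := card_codeF_one (S := S) hS
  have hsplit := Finset.card_filter_add_card_filter_not (s := (univ : Finset (S → Bool)))
    fun f => codeF f = 0
  have hsplit2 := Finset.card_filter_add_card_filter_not
    (s := (univ : Finset (S → Bool)).filter fun f => ¬ codeF f = 0) fun f => codeF f = 1
  have e1 : ((univ : Finset (S → Bool)).filter fun f => ¬ codeF f = 0).filter (fun f => codeF f = 1) =
      univ.filter fun f => codeF f = 1 := by
    ext f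
    simp only [Finset.mem_filter, Finset.mem_univ, true_and]
    constructor
    · exact fun h => h.2
    · intro h
      exact ⟨by rw [h]; decide, h⟩
  have e2 : ((univ : Finset (S → Bool)).filter fun f => ¬ codeF f = 0).filter (fun f => ¬ codeF f = 1) =
      univ.filter fun f => codeF f = 2 := by
    ext f
    simp only [Finset.mem_filter, Finset.mem_univ, true_and]
    constructor
    · rintro ⟨h0, h1⟩
      have : codeF f = 0 ∨ codeF f = 1 ∨ codeF f = 2 := by
        generalize codeF f = t
        fin_cases t <;> simp
      rcases this with h | h | h
      · exact absurd h h0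
      · exact absurd h h1
      · exact h
    · intro h
      exact ⟨by rw [h]; decide, by rw [h]; decide⟩
  rw [e1, e2] at hsplit2
  rw [Finset.card_univ, Fintype.card_fun, Fintype.card_bool] at hsplit
  omega

end OneArc

/-! ## The colourings of the cycle are the triples of their restrictions to the arcs -/

variable (n : ℕ) (i j : Fin (n + 1))

/-- The edges of the first arc. -/
abbrev S₁ := {k : Fin (n + 1) // arc₁ n i k}
/-- The edges of the middle arc. -/
abbrev S₂ := {k : Fin (n + 1) // arc₂ n i j k}
/-- The edges of the last arc. -/
abbrev S₃ := {k : Fin (n + 1) // arc₃ n j k}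

/-- Decidability of the arcs. -/
instance : DecidablePred (arc₁ n i) := fun k => inferInstanceAs (Decidable (k.val < i.val))
/-- Decidability of the arcs. -/
instance : DecidablePred (arc₂ n i j) := fun k => inferInstanceAs (Decidable (i.val ≤ k.val ∧ k.val < j.val))
/-- Decidability of the arcs. -/
instance : DecidablePred (arc₃ n j) := fun k => inferInstanceAs (Decidable (j.val ≤ k.val))

/-- A colouring of the cycle is the triple of its restrictions to the three arcs (`i ≤ j`). -/
def arcsEquiv (hij : i.val ≤ j.val) :
    (Fin (n + 1) → Bool) ≃ (S₁ n i → Bool) × (S₂ n i j → Bool) × (S₃ n j → Bool) where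
  toFun ω := (fun s => ω s.val, fun s => ω s.val, fun s => ω s.val)
  invFun f k :=
    if h1 : arc₁ n i k then f.1 ⟨k, h1⟩
    else if h2 : arc₂ n i j k then f.2.1 ⟨k, h2⟩
    else f.2.2 ⟨k, by unfold arc₁ at h1; unfold arc₂ at h2; unfold arc₃; omega⟩
  left_inv ω := by
    funext k
    by_cases h1 : arc₁ n i k
    · simp only [h1, dite_true]
    · by_cases h2 : arc₂ n i j k
      · simp only [h1, h2, dite_true, dite_false]
      · simp only [h1, h2, dite_false]
  right_inv f := by
    obtain ⟨f₁, f₂, f₃⟩ := f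
    refine Prod.ext ?_ (Prod.ext ?_ ?_)
    · funext s
      obtain ⟨k, hk⟩ := s
      simp only [hk, dite_true]
    · funext s
      obtain ⟨k, hk⟩ := s
      have h1 : ¬ arc₁ n i k := by unfold arc₁; unfold arc₂ at hk; omega
      simp only [h1, hk, dite_true, dite_false]
    · funext s
      obtain ⟨k, hk⟩ := s
      have h1 : ¬ arc₁ n i k := by unfold arc₁; unfold arc₃ at hk; omega
      have h2 : ¬ arc₂ n i j k := by unfold arc₂; unfold arc₃ at hk; omega
      simp only [h1, h2, dite_false]

/-- The code of an arc is the type of the restriction. -/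
theorem code_eq_codeF (A : Fin (n + 1) → Prop) [DecidablePred A] (ω : Fin (n + 1) → Bool) :
    code n A ω = codeF (fun s : {k // A k} => ω s.val) := by
  unfold code codeF allc
  simp only [Subtype.forall]
  split_ifs <;> rfl

/-- A filter on a product by a conjunction of conditions on the factors. -/
theorem card_filter_prod' {α β : Type} [Fintype α] [Fintype β] (P : α → Prop) (Q : β → Prop)
    [DecidablePred P] [DecidablePred Q] :
    #(univ.filter fun x : α × β => P x.1 ∧ Q x.2) = #(univ.filter P) * #(univ.filter Q) := by
  rw [← Finset.univ_product_univ, Finset.filter_product, Finset.card_product]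

/-- The lengths of the arcs. -/
theorem card_S₁ : Fintype.card (S₁ n i) = i.val := by
  rw [Fintype.card_subtype]
  have : (univ.filter fun k : Fin (n + 1) => arc₁ n i k) = Finset.Iio i := by
    ext k
    simp only [Finset.mem_filter, Finset.mem_univ, true_and, Finset.mem_Iio, arc₁, Fin.lt_def]
  rw [this, Fin.card_Iio]

/-- The lengths of the arcs. -/
theorem card_S₂ : Fintype.card (S₂ n i j) = j.val - i.val := by
  rw [Fintype.card_subtype]
  have : (univ.filter fun k : Fin (n + 1) => arc₂ n i j k) = Finset.Ico i j := by
    ext k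
    simp only [Finset.mem_filter, Finset.mem_univ, true_and, Finset.mem_Ico, arc₂, Fin.lt_def, Fin.le_def]
  rw [this, Fin.card_Ico]

/-- The lengths of the arcs. -/
theorem card_S₃ : Fintype.card (S₃ n j) = n + 1 - j.val := by
  rw [Fintype.card_subtype]
  have : (univ.filter fun k : Fin (n + 1) => arc₃ n j k) = Finset.Ici j := by
    ext k
    simp only [Finset.mem_filter, Finset.mem_univ, true_and, Finset.mem_Ici, arc₃, Fin.le_def]
  rw [this, Fin.card_Ici]

open Classical in
/-- The count of colourings of an arc by type, on the subtype. -/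
theorem card_codeF_eq {S : Type} [Fintype S] [DecidableEq S] (hS : Nonempty S) (t : Fin 3) :
    #(univ.filter fun f : S → Bool => codeF f = t) = multN t (Fintype.card S) := by
  match t with
  | 0 => rw [card_codeF_zero]; rfl
  | 1 => rw [card_codeF_one hS]; rfl
  | 2 => rw [card_codeF_two hS]; rfl

open Classical in
/-- **The colourings of the cycle with prescribed arc types**: `1`, `1` or `2^ℓ − 2` per arc, multiplied. -/
theorem card_code_eq (hi : 0 < i.val) (hij : i.val < j.val) (t₁ t₂ t₃ : Fin 3) :
    #(univ.filter fun ω : Fin (n + 1) → Bool =>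
        (code n (arc₁ n i) ω, code n (arc₂ n i j) ω, code n (arc₃ n j) ω) = (t₁, t₂, t₃)) =
      multN t₁ i.val * multN t₂ (j.val - i.val) * multN t₃ (n + 1 - j.val) := by
  have h₁ : Nonempty (S₁ n i) := ⟨⟨0, by unfold arc₁; simp only [Fin.val_zero]; exact hi⟩⟩
  have h₂ : Nonempty (S₂ n i j) := ⟨⟨i, by unfold arc₂; exact ⟨le_rfl, hij⟩⟩⟩
  have h₃ : Nonempty (S₃ n j) := ⟨⟨j, by unfold arc₃; exact le_rfl⟩⟩
  have e : #(univ.filter fun ω : Fin (n + 1) → Bool =>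
      (code n (arc₁ n i) ω, code n (arc₂ n i j) ω, code n (arc₃ n j) ω) = (t₁, t₂, t₃)) =
      #(univ.filter fun f : (S₁ n i → Bool) × (S₂ n i j → Bool) × (S₃ n j → Bool) =>
        codeF f.1 = t₁ ∧ (codeF f.2.1 = t₂ ∧ codeF f.2.2 = t₃)) := by
    refine Finset.card_equiv (arcsEquiv n i j hij.le) fun ω => ?_
    rw [Finset.mem_filter, Finset.mem_filter]
    simp only [Finset.mem_univ, true_and, Prod.mk.injEq, arcsEquiv, Equiv.coe_fn_mk, code_eq_codeF]
  rw [e, card_filter_prod' (fun f₁ : S₁ n i → Bool => codeF f₁ = t₁)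
    (fun p : (S₂ n i j → Bool) × (S₃ n j → Bool) => codeF p.1 = t₂ ∧ codeF p.2 = t₃),
    card_filter_prod' (fun f₂ : S₂ n i j → Bool => codeF f₂ = t₂) (fun f₃ : S₃ n j → Bool => codeF f₃ = t₃),
    card_codeF_eq h₁, card_codeF_eq h₂, card_codeF_eq h₃, card_S₁, card_S₂, card_S₃, mul_assoc]

/-! ## THE CYCLE DICTIONARY -/

variable {V E T₁ T₂ V' E' T₁' T₂' : Type} (Z : ZoneData V E T₁ T₂) (a : V) (Z' : ZoneData V' E' T₁' T₂') (a' : V')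

/-- THE CYCLE ZONE: the cycle `C_{n+1}` through the anchor `0` with `Z` hung at `x_i` and `Z'` at `x_j`. -/
noncomputable abbrev cyc2 : ZoneData ((Fin (n + 1) ⊕ V') ⊕ V) ((Fin (n + 1) ⊕ E') ⊕ E) (T₁' ⊕ T₁) (T₂' ⊕ T₂) :=
  glue2 (cyc n) i j Z a Z' a'

/-- The real multiplicity of a type on an arc of length `ℓ ≥ 1` is mine-3's `multArc (2^ℓ − 2)`. -/
theorem multN_cast (t : Fin 3) {ℓ : ℕ} (hℓ : 1 ≤ ℓ) :
    ((multN t ℓ : ℕ) : ℝ) = multArc ((2 : ℝ) ^ ℓ - 2) (arcOf t) := by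
  have h2 : 2 ≤ 2 ^ ℓ := by
    calc 2 = 2 ^ 1 := by norm_num
      _ ≤ 2 ^ ℓ := Nat.pow_le_pow_right (by norm_num) hℓ
  fin_cases t <;> simp [multN, multArc, arcOf, Nat.cast_sub h2]

section Six

variable [Fintype E] [DecidableEq E] [Fintype T₁] [DecidableEq T₁] [Fintype T₂] [DecidableEq T₂] [Fintype E']
  [DecidableEq E'] [Fintype T₁'] [DecidableEq T₁'] [Fintype T₂'] [DecidableEq T₂']

/-- **THE CYCLE DICTIONARY**: the six-vector of the cycle zone `C_{n+1}` with `Z` at `x_i` and `Z'` at `x_j`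
(`0 < i < j`) is mine-3's arc-type model with the multiplicities `2^ℓ − 2` of the arcs `[0, i)`, `[i, j)`,
`[j, n]`. -/
theorem sixVec_cyc2 (hi : 0 < i.val) (hij : i.val < j.val) :
    (cyc2 n i j Z a Z' a').sixVec (Sum.inl (Sum.inl 0)) =
      thetaCyc ((2 : ℝ) ^ i.val - 2) ((2 : ℝ) ^ (j.val - i.val) - 2) ((2 : ℝ) ^ (n + 1 - j.val) - 2)
        (Z.sixVec a) (Z'.sixVec a') := by
  classical
  rw [sixVec_glue2]
  have e1 : ∀ ω : Fin (n + 1) → Bool,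
      contrib (Z.sixVec a) (Z'.sixVec a') ((cyc n).Mg 0 i ω) ((cyc n).Rd 0 i ω) ((cyc n).Mg 0 j ω)
        ((cyc n).Rd 0 j ω) ((cyc n).Mg i j ω) =
      cycCol (Z.sixVec a) (Z'.sixVec a') (arcOf (code n (arc₁ n i) ω)) (arcOf (code n (arc₂ n i j) ω))
        (arcOf (code n (arc₃ n j) ω)) :=
    fun ω => contrib_cyc n i j ω hi hij _ _
  simp only [e1]
  rw [← Finset.sum_fiberwise (univ : Finset (Fin (n + 1) → Bool))
    (fun ω => (code n (arc₁ n i) ω, code n (arc₂ n i j) ω, code n (arc₃ n j) ω))]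
  have e2 : ∀ t : Fin 3 × Fin 3 × Fin 3,
      (∑ ω ∈ (univ : Finset (Fin (n + 1) → Bool)).filter
          (fun ω => (code n (arc₁ n i) ω, code n (arc₂ n i j) ω, code n (arc₃ n j) ω) = t),
        cycCol (Z.sixVec a) (Z'.sixVec a') (arcOf (code n (arc₁ n i) ω)) (arcOf (code n (arc₂ n i j) ω))
          (arcOf (code n (arc₃ n j) ω))) =
      ((multN t.1 i.val * multN t.2.1 (j.val - i.val) * multN t.2.2 (n + 1 - j.val) : ℕ) : ℝ) •
        cycCol (Z.sixVec a) (Z'.sixVec a') (arcOf t.1) (arcOf t.2.1) (arcOf t.2.2) := by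
    rintro ⟨t₁, t₂, t₃⟩
    rw [Finset.sum_congr rfl (g := fun _ => cycCol (Z.sixVec a) (Z'.sixVec a') (arcOf t₁) (arcOf t₂) (arcOf t₃))
      (fun ω hω => by
        rw [Finset.mem_filter, Prod.mk.injEq, Prod.mk.injEq] at hω
        rw [hω.2.1, hω.2.2.1, hω.2.2.2]),
      Finset.sum_const, card_code_eq n i j hi hij, Nat.cast_smul_eq_nsmul]
  simp only [e2]
  have hℓ₁ : 1 ≤ i.val := hi
  have hℓ₂ : 1 ≤ j.val - i.val := by omega
  have hℓ₃ : 1 ≤ n + 1 - j.val := by have := j.is_le; omega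
  rw [Fintype.sum_prod_type]
  simp only [Fintype.sum_prod_type, Fin.sum_univ_three, Nat.cast_mul, multN_cast _ hℓ₁, multN_cast _ hℓ₂,
    multN_cast _ hℓ₃]
  unfold thetaCyc cycTerm
  simp only [arcOf]
  abel

end Six

end TwoExit

end ZoneZ

end PercRepro
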